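import Summits.BirchSwinnertonDyer.Rank1Residual.X11b.UnrIntegersValuationRing
import Literature.NumberTheory.EllipticCurves.UnrIntegersSqrtNegOne
import HarnessLib

set_option linter.dupNamespace false
set_option autoImplicit false

/-! # `√−1` and the receptacle `R₀ = unrIntegers p` of the BDP frame: NOT in `Frac R₀` at `p = 2`,
IN `R₀` at every odd `p`

Cell `bsd-cn100`, prover seat `bsd-cn100-s2b-c3` (g5). Supports, does not close,
stmt-BirchSwinnertonDyer-19160; serves the S2 items 19080/19079 as negative knowledge. The tree's
frame `IsBDPLFunction ι 𝔭 κ γ f Ω_K Ω_p 𝓛` asks for `𝓛 ∈ R₀⟦T⟧` with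
`R₀ = unrIntegers p = 𝒪(\widehat{ℚ_p^{ur}})` (Castella 2018 §3). The cell's normalisation audit
(MEMO-transfer-12, Prop. 4.1 and Addendum A.2/A.4, 2026-08-26) found that at a Heegner field `K` in
which `p` SPLITS the refereed interpolation constant carries `√D_K = √−1 · √d_K` with `√d_K` a
`p`-adic unit, so the EXACT display is satisfiable in `R₀⟦T⟧` only if `√−1 ∈ Frac R₀`. This file
proves the two arithmetic facts that decide this, over the LANDED structure theory of `R₀`
(`UnrIntegersTeichmuller` / `UnrIntegersValuationRing`, cell `b2b-bsdres`; `UnrIntegersUnits`):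

* `sq_ne_neg_one_of_mem_unrIntegers_two`, `sq_ne_neg_one_of_mem_fracUnr_two`,
  `not_isSquare_neg_one_unrIntegers_two` — **at `p = 2`, `−1` is not a square in `R₀`, nor in
  `Frac R₀ = Subfield.closure R₀`** (so the exact (LB-exist) at `p = 2` is unsatisfiable as typed —
  the kernel of MEMO-12 Prop. 4.1; the registered ♯ frame `IsBDPLFunctionUpTo C` puts `√−1` in `C`);
* `isSquare_neg_one_unrIntegers_of_ne_two` — **at every odd `p`, `√−1 ∈ R₀`**, the `IsSquare` form of
  the tree's `exists_sq_eq_neg_one_mem_unrIntegers` (`Literature/…/UnrIntegersSqrtNegOne.lean`, transfer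
  g9: `ζ₈ ∈ R₀`) — the clause «`√−1 ∈ ℚ₉ ⊂ ℚ₃^{ur}`» of MEMO-12 A.4 for which the EXACT S2b lines
  `three-adic-bdp-triple` v5cp / `heegner-field-bdp-triple` v6bp stand at `p = 3`;
* `isSquare_neg_one_unrIntegers_iff` — the dichotomy `IsSquare (−1 : R₀) ↔ p ≠ 2`.

Proof at `p = 2` (folklore, `W(𝔽̄₂)/4` has no element of square `−1`): approximate `x ∈ R₀` with
`x² = −1` by `z ∈ ℤ[μ_{2'}]` within `1/4`; write `z = t + 2b` with a Teichmüller digit `t`,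
`t^{2^f} = t` (`R1.exists_teichmuller_limit`); then `‖t² + 1‖ ≤ 1/4`, and `s := t²` has odd order
`m = 2^f − 1`, so `2 = s^m + 1 = (s + 1) · (alternating sum)` has norm `≤ 1/4 < 1/2` — absurd.
HONEST FRAMING: elementary `p`-adic algebra about a Literature definition; nothing about any curve,
crux A/B, the leaves, the congruent number problem, Sylvester's conjecture or BSD is proved.
PARTITION: none — RANK axis.

[cite: Castella2018, §3 (p. 9) (the ring R₀)] [cite: SerreLocalFields1979, Ch. II §4 Prop. 8 and Ch. IV §4]
-/

noncomputable section

open scoped Classical Topology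

namespace Summit.BirchSwinnertonDyer.BirchSwinnertonDyer.Theorems.MordellShaFreeCutUnrIntegersSqrtNegOne

open Filter Literature.NumberTheory.EllipticCurves
open Literature.NumberTheory.LFunctions.Dwork (norm_natCast_p_padicComplex)
open Summit.BirchSwinnertonDyer.Rank1Residual.X11b

/-! ## 1. Odd `p`: `√−1 ∈ R₀` (the landed Literature lemma, in `IsSquare` form) -/

section OddP

variable {p : ℕ} [hp : Fact p.Prime]

/-- **`−1` is a square in `R₀ = unrIntegers p` for odd `p`** — the `IsSquare` form of the tree's
`exists_sq_eq_neg_one_mem_unrIntegers` (`Literature/…/UnrIntegersSqrtNegOne.lean`, cell seat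
`bsd-cn100-transfer` g9: `ζ₈ ∈ R₀`, `ζ₈⁴ = −1`). (MEMO-transfer-12 A.4: «`√−1 ∈ ℚ₉ ⊂ ℚ₃^{ur}`» — why
the exact BDP display is unit-exact at a split ODD prime.) [folklore] [cite: Castella2018, §3 (p. 9)] -/
theorem isSquare_neg_one_unrIntegers_of_ne_two (hp2 : p ≠ 2) : IsSquare (-1 : unrIntegers p) := by
  obtain ⟨i, hi, hi2⟩ := exists_sq_eq_neg_one_mem_unrIntegers (p := p) hp2
  refine ⟨⟨i, hi⟩, Subtype.ext ?_⟩
  simp only [NegMemClass.coe_neg, OneMemClass.coe_one, Subring.coe_mul]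
  rw [← sq, hi2]

end OddP

/-! ## 2. `p = 2`: `√−1 ∉ Frac R₀` -/

section Two

/-- `2` is prime (local `Fact` instance for `unrIntegers 2`, `ℂ_[2]`). [folklore] -/
private instance factPrimeTwo : Fact (Nat.Prime 2) := ⟨Nat.prime_two⟩

/-- `‖2‖ = 1/2` in `ℂ₂`. [folklore] -/
private theorem norm_two : ‖(2 : ℂ_[2])‖ = (2 : ℝ)⁻¹ := by
  simpa using norm_natCast_p_padicComplex (p := 2)

/-- If `s` has norm `≤ 1` and `m` is odd then `‖s ^ m + 1‖ ≤ ‖s + 1‖`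
(`s^m + 1 = (s + 1) · Σ_{i<m} (−s)^i`). [folklore] -/
private theorem norm_pow_add_one_le {s : ℂ_[2]} (hs : ‖s‖ ≤ 1) {m : ℕ} (hm : Odd m) :
    ‖s ^ m + 1‖ ≤ ‖s + 1‖ := by
  have hgeom : s ^ m + 1 = (s + 1) * (Finset.range m).sum (fun i ↦ (-s) ^ i) := by
    have h := (Commute.all (-s : ℂ_[2]) 1).geom_sum₂_mul m
    -- `(Σ (-s)^i 1^(m-1-i)) * (-s - 1) = (-s)^m - 1^m`
    simp only [one_pow, mul_one] at h
    have hodd : (-s) ^ m = -(s ^ m) := Odd.neg_pow hm s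
    rw [hodd] at h
    have : (s + 1) * (Finset.range m).sum (fun i ↦ (-s) ^ i) =
        -((Finset.range m).sum (fun i ↦ (-s) ^ i) * (-s - 1)) := by ring
    rw [this, h]; ring
  rw [hgeom, norm_mul]
  refine mul_le_of_le_one_right (norm_nonneg _) ?_
  refine IsUltrametricDist.norm_sum_le_of_forall_le_of_nonneg zero_le_one fun i _ ↦ ?_
  rw [norm_pow, norm_neg]
  exact pow_le_one₀ (norm_nonneg _) hs

/-- **At `p = 2`, no element of `R₀ = unrIntegers 2` has square `−1`** (i.e. `√−1 ∉ 𝒪(\widehat{ℚ₂^{ur}})`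
= `W(𝔽̄₂)`): Teichmüller digit + `s^m + 1 = (s+1)(…)` for the odd order `m` of `t²`. The kernel of
MEMO-transfer-12 Prop. 4.1 (the exact (LB-exist) at `p = 2` is unsatisfiable as typed). [folklore]
[cite: SerreLocalFields1979, Ch. II §4 Prop. 8 (Teichmüller representatives) and Ch. IV §4] -/
theorem sq_ne_neg_one_of_mem_unrIntegers_two {x : ℂ_[2]} (hx : x ∈ unrIntegers 2) : x ^ 2 ≠ -1 := by
  intro hx2
  -- (1) approximate `x` by `z` in the generated subring within `1/4`
  have hxcl : x ∈ closure ((Subring.closure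
      {ζ : ℂ_[2] | ∃ m : ℕ, 0 < m ∧ ¬ 2 ∣ m ∧ ζ ^ m = 1} : Subring ℂ_[2]) : Set ℂ_[2]) := hx
  obtain ⟨z, hz, hxz⟩ := Metric.mem_closure_iff.mp hxcl (4⁻¹) (by norm_num)
  rw [dist_eq_norm] at hxz
  -- (2) Teichmüller digit: `z = t + 2 b`, `t ^ 2 ^ f = t`
  obtain ⟨f, hf, hdvd⟩ := R1.exists_frobCong_of_mem_rootsSubring (p := 2) hz
  obtain ⟨t, -, htmem, htpow, hb⟩ := R1.exists_teichmuller_limit (p := 2) _ hf hdvd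
  simp only at hb
  have h2ne : (2 : ℂ_[2]) ≠ 0 := two_ne_zero
  have hzt : ‖z - t‖ ≤ 2⁻¹ := by
    have h := Halves.norm_le_one_of_mem_unrIntegers 2 hb
    rw [norm_div, norm_natCast_p_padicComplex (p := 2), div_le_one (by positivity)] at h
    exact_mod_cast h
  -- norms ≤ 1 everywhere
  have hx1 : ‖x‖ ≤ 1 := Halves.norm_le_one_of_mem_unrIntegers 2 hx
  have ht1 : ‖t‖ ≤ 1 := Halves.norm_le_one_of_mem_unrIntegers 2 htmem
  have hz1 : ‖z‖ ≤ 1 :=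
    Halves.norm_le_one_of_mem_unrIntegers 2 (Subring.le_topologicalClosure _ hz)
  -- (3) `‖t² + 1‖ ≤ 1/4`: `t² + 1 = (t² − z²) + (z² − x²) + (x² + 1)` and `x² + 1 = 0`
  have hA : ‖t ^ 2 - z ^ 2‖ ≤ 4⁻¹ := by
    have e : t ^ 2 - z ^ 2 = (t - z) * (t - z) + 2 * (z * (t - z)) := by ring
    rw [e]
    refine (IsUltrametricDist.norm_add_le_max _ _).trans (max_le ?_ ?_)
    · rw [norm_mul, ← norm_neg (t - z), neg_sub]
      calc ‖z - t‖ * ‖z - t‖ ≤ 2⁻¹ * 2⁻¹ :=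
            mul_le_mul hzt hzt (norm_nonneg _) (by norm_num)
        _ = 4⁻¹ := by norm_num
    · rw [norm_mul, norm_mul, norm_two, ← norm_neg (t - z), neg_sub]
      calc (2 : ℝ)⁻¹ * (‖z‖ * ‖z - t‖) ≤ 2⁻¹ * (1 * 2⁻¹) := by
            gcongr
        _ = 4⁻¹ := by norm_num
  have hB : ‖z ^ 2 - x ^ 2‖ ≤ 4⁻¹ := by
    have e : z ^ 2 - x ^ 2 = (z + x) * -(x - z) := by ring
    rw [e, norm_mul, norm_neg]
    calc ‖z + x‖ * ‖x - z‖ ≤ 1 * 4⁻¹ := by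
          refine mul_le_mul ?_ hxz.le (norm_nonneg _) zero_le_one
          exact (IsUltrametricDist.norm_add_le_max _ _).trans (max_le hz1 hx1)
      _ = 4⁻¹ := one_mul _
  have hC : ‖t ^ 2 + 1‖ ≤ 4⁻¹ := by
    have e : t ^ 2 + 1 = (t ^ 2 - z ^ 2) + (z ^ 2 - x ^ 2) := by rw [hx2]; ring
    rw [e]
    exact (IsUltrametricDist.norm_add_le_max _ _).trans (max_le hA hB)
  -- (4) `t ≠ 0`, so `s := t²` satisfies `s ^ (2^f - 1) = 1` with `2^f - 1` odd
  have ht0 : t ≠ 0 := by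
    rintro rfl
    have : ‖(0 : ℂ_[2]) ^ 2 + 1‖ ≤ 4⁻¹ := hC
    norm_num at this
  have hN : 1 ≤ 2 ^ f := Nat.one_le_two_pow
  have hs1 : (t ^ 2) ^ (2 ^ f - 1) = 1 := by
    have h1 : t ^ (2 ^ f - 1) = 1 := by
      have : t * (t ^ (2 ^ f - 1) - 1) = 0 := by
        rw [mul_sub, mul_one, ← pow_succ', Nat.sub_add_cancel hN, htpow, sub_self]
      rcases mul_eq_zero.mp this with h | h
      · exact absurd h ht0
      · exact sub_eq_zero.mp h
    rw [← pow_mul, mul_comm, pow_mul, h1, one_pow]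
  have hodd : Odd (2 ^ f - 1) := by
    have : Even (2 ^ f) := (Nat.even_pow' hf.ne').mpr even_two
    exact Nat.Even.sub_odd hN this odd_one
  -- (5) `2 = s^m + 1` has norm `≤ ‖s + 1‖ ≤ 1/4 < 1/2`
  have hle : ‖(t ^ 2) ^ (2 ^ f - 1) + 1‖ ≤ ‖t ^ 2 + 1‖ :=
    norm_pow_add_one_le (by rw [norm_pow]; exact pow_le_one₀ (norm_nonneg _) ht1) hodd
  rw [hs1, show (1 : ℂ_[2]) + 1 = 2 by norm_num, norm_two] at hle
  have : (2 : ℝ)⁻¹ ≤ 4⁻¹ := hle.trans hC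
  norm_num at this

/-- **At `p = 2`, `−1` is not a square in `Frac R₀ = Subfield.closure R₀`** (`= R₀[1/2]
= \widehat{ℚ₂^{ur}}`): a square root of `−1` has norm `1`, hence lies in the valuation ring `R₀`
(`R1.mem_unrIntegers_of_mem_fracUnr`), contradicting `sq_ne_neg_one_of_mem_unrIntegers_two`. This is
the statement «`√−1 ∉ Frac (unrIntegers 2)`» behind MEMO-transfer-12 Prop. 4.1. [folklore]
[cite: SerreLocalFields1979, Ch. IV §4] -/
theorem sq_ne_neg_one_of_mem_fracUnr_two {w : ℂ_[2]}
    (hw : w ∈ Subfield.closure (unrIntegers 2 : Set ℂ_[2])) : w ^ 2 ≠ -1 := by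
  intro hw2
  have hw1 : ‖w‖ ≤ 1 := by
    have h : ‖w‖ ^ 2 = 1 := by rw [← norm_pow, hw2, norm_neg, norm_one]
    have := (pow_eq_one_iff_of_nonneg (norm_nonneg w) two_ne_zero).mp h
    exact this.le
  exact sq_ne_neg_one_of_mem_unrIntegers_two (R1.mem_unrIntegers_of_mem_fracUnr hw hw1) hw2

/-- **`−1` is not a square in `R₀ = unrIntegers 2`.** [folklore] [cite: SerreLocalFields1979, Ch. IV §4] -/
theorem not_isSquare_neg_one_unrIntegers_two : ¬ IsSquare (-1 : unrIntegers 2) := by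
  rintro ⟨r, hr⟩
  refine sq_ne_neg_one_of_mem_unrIntegers_two r.2 ?_
  have h := congrArg (fun y : unrIntegers 2 ↦ (y : ℂ_[2])) hr
  simp only [NegMemClass.coe_neg, OneMemClass.coe_one, Subring.coe_mul] at h
  rw [sq, ← h]

/-- **No element `C` of `Frac R₀` at `p = 2` squares to `−d` for a `d ∈ Frac R₀` that is a square there**
— the form in which MEMO-12 uses it: `√D_K = √−1·√d_K` with `√d_K ∈ ℤ₂ˣ ⊂ R₀`, so `√D_K ∉ Frac R₀`.
[folklore] [cite: SerreLocalFields1979, Ch. IV §4] -/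
theorem sq_ne_neg_sq_of_mem_fracUnr_two {c r : ℂ_[2]}
    (hc : c ∈ Subfield.closure (unrIntegers 2 : Set ℂ_[2]))
    (hr : r ∈ Subfield.closure (unrIntegers 2 : Set ℂ_[2])) (hr0 : r ≠ 0) :
    c ^ 2 ≠ -(r ^ 2) := by
  intro h
  refine sq_ne_neg_one_of_mem_fracUnr_two (w := c / r) (div_mem hc hr) ?_
  rw [div_pow, h, neg_div, div_self (pow_ne_zero 2 hr0)]

end Two

/-! ## 3. The dichotomy -/

section Dichotomy

variable {p : ℕ} [hp : Fact p.Prime]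

/-- **`−1` is a square in `R₀ = unrIntegers p` if and only if `p` is odd** (`W(𝔽̄_p) ∋ √−1 ⟺ p ≠ 2`):
the rule «the BDP display is unit-exact at a split prime `p` iff `p` is odd» of MEMO-transfer-12 A.4 at
the level of the receptacle. [folklore] [cite: SerreLocalFields1979, Ch. IV §4] -/
theorem isSquare_neg_one_unrIntegers_iff : IsSquare (-1 : unrIntegers p) ↔ p ≠ 2 := by
  refine ⟨fun h h2 ↦ ?_, isSquare_neg_one_unrIntegers_of_ne_two⟩
  subst h2
  exact not_isSquare_neg_one_unrIntegers_two h

end Dichotomy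

end Summit.BirchSwinnertonDyer.BirchSwinnertonDyer.Theorems.MordellShaFreeCutUnrIntegersSqrtNegOne

end
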